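import Summits.BirchSwinnertonDyer.BirchSwinnertonDyer.Theorems.PrintCf2RubinValueTwoKatzMeasureJZeroClassLattices
import Summits.BirchSwinnertonDyer.BirchSwinnertonDyer.Theorems.PrintCf2RubinValueTwoKatzMeasureJZeroReadingConjugacy
import Literature.NumberTheory.EllipticCurves.EisensteinNumbers
import Literature.NumberTheory.GaloisRepresentations.LubinTateComparisonTraceTransportRelTwo
import HarnessLib

/-!
# Glue for the `j = 0` seam values [I2]: lattice presentations (`Ω·ι𝔪` integral vs fractional, generators), the ONE homogeneity
# `E_k(z; Λ) = c^k·E_k(cz; cΛ)` between two scales, and the `𝔓`-adic / complex READING identities `hρ`, `hQθ` of the value formulas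

Cell `bsd-print-cf2`, width seat `bsd-line-cf2-p1-w8` g13 (piece V1-glue of the seam values, 11:27:04Z plan (E5)); `--supports` the crux
stmt-BirchSwinnertonDyer-20368 (helper, Theses-free).  THEOREMS ONLY; no `def`, no named fact, no `sorry`.

* §1 `latticeSpec_coeIdeal` — `Λ = Ω·ι(𝔪)` in the integral form (`∃ a ∈ 𝔪`) IS hsum's fractional form (`∃ x ∈ (𝔪 : FractionalIdeal)`);
  `latticeSpec_span_singleton_mul` — `Ω·ι(𝔣) = (Ω/ι c)·ι((c)·𝔣)` (the bridge's base point `Ω_𝔪 = Ω_E/ι(μ_𝔪)` for `𝔪 = (μ_𝔪)`, `h_K = 1`);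
  `latticeSpec_div_of_idealInvLattice` — `𝔞⁻¹(Ω·ι𝔪) = Ω·ι(𝔪/𝔞)` (re-export of `mem_idealInvLattice_iff_exists_mem_div` for a second pair).
* §2 ★ `eisensteinE_eq_mul_eisensteinE_of_specs` — two period pairs presenting `Ω·ιJ` and `Ω′·ιJ` (`Ω′ = c·Ω`, `J` fractional) have
  `E_k(z; Λ_Ω) = c^k · E_k(c·z; Λ_{Ω′})` (`mulLeft` + `eisensteinE_eq_of_lattice_eq`): the rescaling `Ω_𝔪 → Ω_E` of the values.
* §3 ★ `readingHom_comp_algebraMap_LTCoeff` — `hρ` of the value formulas for `ρ_E := θ ∘ (𝒪_E → 𝒪_{ℂ_{K_v}})`, `φ_F := θ ∘ (K_v → ℂ_{K_v})`;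
  ★ `readingHom_comp_eq_of_reading_conj` — `hQθ`: `ρ_E ∘ ψ = ι⁻¹ ∘ φ_ℂ` with `φ_ℂ := ι̂_∞ ∘ (τ⁻¹ •) ∘ j` from the reading conjugacy
  `θ ∘ ι̂_v ∘ τ = ι⁻¹ ∘ ι̂_∞` (Q-θ, `KatzMeasureJZeroTop.exists_absGal_reading_conj_of_split`) and `ψ r = ι̂_v (j r)`;
  `theta_algebraMap_eq_of_reading_conj` — on `K`: `θ(k) = ι⁻¹(w₀ k)`.

Nothing here closes a crux; no summit statement is proved; BSD is not proved by any of this.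
References: [deShalit1987] II §2.3 (10) (p. 42), II §3.1 (5) (p. 49), II §4.2 (6) (p. 57), II §4.14 (38)–(40) (p. 71–72).
-/

-- the summit namespace `Summit.BirchSwinnertonDyer.BirchSwinnertonDyer` repeats the problem name by design (D-0017)
set_option linter.dupNamespace false
set_option autoImplicit false

noncomputable section

open scoped Classical nonZeroDivisors
open NumberField IsDedekindDomain Field ValuativeRel PeriodPair
open Literature.NumberTheory.ComplexMultiplication.EllipticUnits
open Literature.NumberTheory.GaloisRepresentations Literature.NumberTheory.GaloisRepresentations.IsNonarchimedeanLocalField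
  Literature.NumberTheory.GaloisRepresentations.LubinTate Literature.NumberTheory.PAdicHodge

namespace Summit.BirchSwinnertonDyer.BirchSwinnertonDyer.Theorems.PrintCf2.KatzMeasureJZeroSeam

variable {K : Type} [Field K] [NumberField K]

/-! ## §1 Lattice presentations -/

omit [NumberField K] in
/-- `Λ = Ω·ι(𝔪)`: the integral presentation `∃ a ∈ 𝔪, z = Ω·ι a` is the fractional one `∃ x ∈ (𝔪 : FractionalIdeal), z = Ω·ι x`
(hsum's `hL` at `𝔟 = 1`). [cite: deShalit1987, II §2.3 (10) (p. 42)] -/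
theorem latticeSpec_coeIdeal (ι : K →+* ℂ) {𝔪 : Ideal (𝓞 K)} {Ω : ℂ} {P : PeriodPair}
    (hP : ∀ z : ℂ, z ∈ P.lattice ↔ ∃ a ∈ 𝔪, z = Ω * ι (a : K)) (z : ℂ) :
    z ∈ P.lattice ↔ ∃ x ∈ (𝔪 : FractionalIdeal (𝓞 K)⁰ K), z = Ω * ι x := by
  rw [hP]
  constructor
  · rintro ⟨a, ha, rfl⟩
    exact ⟨(a : K), FractionalIdeal.mem_coeIdeal_of_mem _ ha, rfl⟩
  · rintro ⟨x, hx, rfl⟩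
    obtain ⟨a, ha, rfl⟩ := (FractionalIdeal.mem_coeIdeal _).mp hx
    exact ⟨a, ha, rfl⟩

omit [NumberField K] in
/-- **`Ω·ι(𝔣) = (Ω/ι c)·ι((c)·𝔣)`** for `c ≠ 0`: the model lattice `Λ_W = Ω_E·ι(𝒪_K)` presented at level `𝔪 = (μ)` as `Ω_𝔪·ι(𝔪)`,
`Ω_𝔪 = Ω_E/ι(μ)` (de Shalit II §4.2 (6) «we assume `L = Ω𝔣`»). [cite: deShalit1987, II §4.2 (6) (p. 57), II §2.3 (10) (p. 42)] -/
theorem latticeSpec_span_singleton_mul (ι : K →+* ℂ) {𝔣 : Ideal (𝓞 K)} {Ω : ℂ} {P : PeriodPair}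
    (hP : ∀ z : ℂ, z ∈ P.lattice ↔ ∃ a ∈ 𝔣, z = Ω * ι (a : K)) {c : 𝓞 K} (hc : c ≠ 0) (z : ℂ) :
    z ∈ P.lattice ↔ ∃ a ∈ Ideal.span {c} * 𝔣, z = Ω / ι (c : K) * ι (a : K) := by
  have hιc : ι (c : K) ≠ 0 := (map_ne_zero ι).mpr (by exact_mod_cast hc)
  rw [hP]
  constructor
  · rintro ⟨a, ha, rfl⟩
    refine ⟨c * a, Ideal.mem_span_singleton_mul.mpr ⟨a, ha, rfl⟩, ?_⟩
    push_cast
    rw [map_mul]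
    field_simp
  · rintro ⟨b, hb, rfl⟩
    obtain ⟨a, ha, rfl⟩ := Ideal.mem_span_singleton_mul.mp hb
    refine ⟨a, ha, ?_⟩
    push_cast
    rw [map_mul]
    field_simp

/-- **`𝔞⁻¹(Ω·ι𝔪) = Ω·ι(𝔪/𝔞)`** for a period pair `La` WITH lattice the colon lattice: hsum's `hL𝔞` form from the bridge's `hLa`.
[cite: deShalit1987, II §2.3 (10) (p. 42)] -/
theorem latticeSpec_div_of_idealInvLattice (ι : K →+* ℂ) {𝔪 𝔞 : Ideal (𝓞 K)} (h𝔞 : 𝔞 ≠ ⊥) {Ω : ℂ} (hΩ : Ω ≠ 0)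
    {P La : PeriodPair} (hP : ∀ z : ℂ, z ∈ P.lattice ↔ ∃ a ∈ 𝔪, z = Ω * ι (a : K))
    (hLa : La.lattice = idealInvLattice ι 𝔞 P.lattice) (z : ℂ) :
    z ∈ La.lattice ↔ ∃ x ∈ ((𝔪 : FractionalIdeal (𝓞 K)⁰ K) / (𝔞 : FractionalIdeal (𝓞 K)⁰ K)), z = Ω * ι x := by
  rw [hLa]
  exact KatzMeasureJZeroTop.mem_idealInvLattice_iff_exists_mem_div ι h𝔞 hΩ hP z

/-! ## §2 The one homogeneity between two scales -/

omit [NumberField K] in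
/-- ★ **`E_k(z; Λ_Ω) = c^k·E_k(cz; Λ_{Ω′})`** for two period pairs presenting the SAME fractional ideal `J` at scales `Ω` and `Ω′ = c·Ω`
(`Λ_{Ω′} = c·Λ_Ω`, `E_k(cz; cΛ) = c^{-k}E_k(z; Λ)`). [cite: deShalit1987, II §3.1 (5) (p. 49)] -/
theorem eisensteinE_eq_mul_eisensteinE_of_specs (ι : K →+* ℂ) (J : FractionalIdeal (𝓞 K)⁰ K) {Ω Ω' c : ℂ} (hc : c ≠ 0)
    (hΩ' : Ω' = c * Ω) {P P' : PeriodPair} (hP : ∀ z : ℂ, z ∈ P.lattice ↔ ∃ x ∈ J, z = Ω * ι x)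
    (hP' : ∀ z : ℂ, z ∈ P'.lattice ↔ ∃ x ∈ J, z = Ω' * ι x) (k : ℕ) (z : ℂ) :
    P.eisensteinE k z = c ^ k * P'.eisensteinE k (c * z) := by
  have hlat : (P.mulLeft c hc).lattice = P'.lattice := by
    ext w
    rw [PeriodPair.mem_mulLeft_lattice, hP, hP']
    constructor
    · rintro ⟨x, hx, h⟩
      exact ⟨x, hx, by rw [hΩ', mul_assoc, ← h, ← mul_assoc, mul_inv_cancel₀ hc, one_mul]⟩
    · rintro ⟨x, hx, rfl⟩
      exact ⟨x, hx, by rw [hΩ', ← mul_assoc, ← mul_assoc, inv_mul_cancel₀ hc, one_mul]⟩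
  rw [← PeriodPair.eisensteinE_eq_of_lattice_eq hlat, P.eisensteinE_mulLeft hc k z, ← mul_assoc, mul_inv_cancel₀ (pow_ne_zero k hc),
    one_mul]

/-! ## §3 The reading identities `hρ`, `hQθ` of the value formulas -/

section Readings

attribute [local instance] ltNormUniformSpace ltNormIsUniformAddGroup rk1 nF nE fintypeResidueField

variable {v : HeightOneSpectrum (𝓞 K)} (θ : CompletedAlgClosure (v.adicCompletion K) →+* ℂ_[2])
  (E : IntermediateField (v.adicCompletion K) (AlgebraicClosure (v.adicCompletion K))) [FiniteDimensional (v.adicCompletion K) E]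

/-- ★ **`hρ`**: the reading `ρ_E := θ ∘ (𝒪_E → 𝒪_{ℂ_{K_v}})` restricted to the coefficients `𝒪_{K_v}` is `φ_F := θ ∘ (K_v → ℂ_{K_v})`.
[cite: deShalit1987, I §3.8 (p. 20)] -/
theorem readingHom_comp_algebraMap_LTCoeff :
    (θ.comp ((CBall (v.adicCompletion K)).subtype.comp (unitBallToCBall E))).comp
        (algebraMap (LTCoeff (v.adicCompletion K)) (unitBall E)) =
      (θ.comp (algebraMap (v.adicCompletion K) (CompletedAlgClosure (v.adicCompletion K)))).comp
        ((algebraMap 𝒪[v.adicCompletion K] (v.adicCompletion K)).comp (LTCoeff.of (v.adicCompletion K)).symm.toRingHom) := by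
  refine RingHom.ext fun c ↦ ?_
  have h : algebraMap (LTCoeff (v.adicCompletion K)) (unitBall E) c =
      algebraMap 𝒪[v.adicCompletion K] (unitBall E) ((LTCoeff.of (v.adicCompletion K)).symm c) := by
    rw [← RingEquiv.apply_symm_apply (LTCoeff.of (v.adicCompletion K)) c]; rfl
  simp only [RingHom.comp_apply, Subring.subtype_apply, RingEquiv.toRingHom_eq_coe, RingHom.coe_coe]
  rw [h, coe_unitBallToCBall_algebraMap]
  rfl

/-- **On `K` the two readings agree**: `θ(k) = ι⁻¹(w₀ k)` in `ℂ₂` for `k ∈ K` (the reading conjugacy at `x = k ∈ K ⊂ K̄`, fixed by `τ`).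
[cite: deShalit1987, II §4.3 (7) (p. 57), II §4.14 (38) (p. 71)] -/
theorem theta_algebraMap_eq_of_reading_conj (ιp : PadicAlgCl 2 ≃+* ℂ) (w₀ : InfinitePlace K) {τ : absoluteGaloisGroup K}
    (hτ : ∀ x : AlgebraicClosure K,
      θ (algClosureToC (v.adicCompletion K) (absClosureEmbedding K (v.adicCompletion K) (τ • x))) =
        algebraMap (PadicAlgCl 2) ℂ_[2] (ιp.symm (algClosureEmb w₀.embedding x))) (k : K) :
    θ (algebraMap (v.adicCompletion K) (CompletedAlgClosure (v.adicCompletion K)) (k : v.adicCompletion K)) =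
      algebraMap (PadicAlgCl 2) ℂ_[2] (ιp.symm (w₀.embedding k)) := by
  have h := hτ (algebraMap K (AlgebraicClosure K) k)
  rw [smul_algebraMap, AlgHom.commutes,
    IsScalarTower.algebraMap_apply K (v.adicCompletion K) (AlgebraicClosure (v.adicCompletion K)) k, algClosureToC_algebraMap,
    algClosureEmb_algebraMap] at h
  exact h

/-- ★ **`hQθ`**: for a data ring `R` read `𝔓`-adically by `ψ : R → 𝒪_E` and algebraically by `j : R → K̄` with `ψ r = ι̂_v(j r)` in `K̄_v`,
and the reading conjugacy `θ ∘ ι̂_v ∘ τ = ι⁻¹ ∘ ι̂_∞` on `K̄` (Q-θ): **`ρ_E ∘ ψ = ι⁻¹ ∘ φ_ℂ`** with `φ_ℂ := ι̂_∞ ∘ (τ⁻¹ •) ∘ j` — the complex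
reading of the value formulas is the `τ⁻¹`-MOVED one. [cite: deShalit1987, II §4.3 (7) (p. 57), II §4.14 (38) (p. 71)] -/
theorem readingHom_comp_eq_of_reading_conj (ιp : PadicAlgCl 2 ≃+* ℂ) (w₀ : InfinitePlace K) {τ : absoluteGaloisGroup K}
    (hτ : ∀ x : AlgebraicClosure K,
      θ (algClosureToC (v.adicCompletion K) (absClosureEmbedding K (v.adicCompletion K) (τ • x))) =
        algebraMap (PadicAlgCl 2) ℂ_[2] (ιp.symm (algClosureEmb w₀.embedding x)))
    {R : Type*} [CommRing R] (ψ : R →+* unitBall E) (j : R →+* AlgebraicClosure K)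
    (hψj : ∀ r : R, ((((ψ r : unitBall E) : E) : AlgebraicClosure (v.adicCompletion K))) = absClosureEmbedding K (v.adicCompletion K) (j r)) :
    (θ.comp ((CBall (v.adicCompletion K)).subtype.comp (unitBallToCBall E))).comp ψ =
      ((algebraMap (PadicAlgCl 2) ℂ_[2]).comp ιp.symm.toRingHom).comp
        ((algClosureEmb w₀.embedding).comp ((MulSemiringAction.toRingHom (absoluteGaloisGroup K) (AlgebraicClosure K) τ⁻¹).comp j)) := by
  refine RingHom.ext fun r ↦ ?_
  simp only [RingHom.comp_apply, Subring.subtype_apply, RingEquiv.toRingHom_eq_coe, RingHom.coe_coe, MulSemiringAction.toRingHom_apply]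
  rw [coe_unitBallToCBall, hψj, ← hτ (τ⁻¹ • j r), smul_smul, mul_inv_cancel, one_smul]

end Readings

end Summit.BirchSwinnertonDyer.BirchSwinnertonDyer.Theorems.PrintCf2.KatzMeasureJZeroSeam

end
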